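import Summits.PneNP.PneNP.Theorems.BruckRyserSosSosBlindPlanes

/-!
# Line `effective-threshold` for crux K3 = `SosBlindPlanesLinear` (stmt-PneNP-16763) of route
PneNP/BruckRyserSos — forward rung G1 above the proved floor `SosBlindPlanes` (stmt-PneNP-16761)

RUNG `EffectiveSosBlindPlanes`: the floor `∀ d, ∃ N, ∀ n ≥ N, excluded n → BlindAt d n` with the
threshold made EXPLICIT at the scale of the floor's own trace board, `N d = (d+2)^(C (d+2))`
(⇔ degree-`c log n / log log n` SOS blindness of `¬PP(n)` at every large Bruck–Ryser–Chowla order).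

Ladder (all arrows proved in this file): `SosBlindPlanesLinear (K3, open) → EffectiveSosBlindPlanes
(this rung, open) → SosBlindPlanes (floor, proved)`; the rung is a NECESSARY WAYPOINT of K3.

FORWARD (G1 next-rung, unit fwd-rung-PneNP-01): seed = g1-PneNP-16761 ;
witness = `Summit.PneNP.PneNP.Theorems.SosBlindPlanes.sosBlindPlanes_proof` (floor, stmt-PneNP-16761, proved) ;
rung_of = `Summit.PneNP.PneNP.Theses.BruckRyserSos.SosBlindPlanes` ;
rung_decl = `Summit.PneNP.PneNP.Cruxes.SosBlindPlanesLinear.EffectiveThreshold.EffectiveSosBlindPlanes` ;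
special_file = `Lines/EffectiveSosBlindPlanes_special.lean` (floor ⊢ `∃ N, ThreshRung N`, `∀ d, DegreeRung (fun _ => d)`; rc 0, no sorry) ;
step = parameter: the threshold `N d` from `∃ N` to the explicit `(d+2)^(C(d+2))` ;
disposition = frontier (ladder capped at static semialgebraic DEGREE bounds; the lift to all proof
systems is the parent's crux `NoPolyBoundedProofSystem` ≡ NP ≠ coNP, stmt-PneNP-0097).

Skeleton: two registered stubs and the kernel-checked composition `EffectiveSosBlindPlanes_of`.
* `stub_effectiveTransfer` (load-bearing, L/XL): an EFFECTIVE replacement of the floor's one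
  non-effective step `eventually_const_of_isSemialgebraic` (…Formula.lean) — for all
  `n ≥ (d+2)^(C(d+2))` some template table satisfies `GoodPt d n μ`. Generic effective quantifier
  elimination only gives tower-type thresholds here (k = number of templates ≈ (d+2)^{2d} quantified
  variables), so the stub needs the STRUCTURE of the feasibility set: fibres are spectrahedra, linear
  in the table, polynomial in the order, with genuine points (relabelled `PG(2,p)`) at EVERY prime.
* `stub_traceBoard_le_pow` (S/M): the explicit size of the architecture, `Nsos d + (d+1) ≤ (d+2)^(2(d+2))`
  (`K₁ d = |Idx (d+1) (d/2)|² ≤ (d+2)^{2d}`), so that the floor's Build section applies at the rung's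
  threshold.
* `blindAt_of_goodPt` (PROVED, the floor's Build verbatim) and `EffectiveSosBlindPlanes_of` (PROVED).
-/

set_option linter.dupNamespace false

noncomputable section

namespace Summit.PneNP.PneNP.Cruxes.SosBlindPlanesLinear.EffectiveThreshold

open Literature.Computability.MetaComplexity
open Summit.PneNP.PneNP.Theses.BruckRyserSos
open Summit.PneNP.PneNP.Theorems.SosBlindPlanes

/-- Degree-`d` SOS blindness of the projective-plane system of order `n` (board `v = n² + n + 1`,
variable `x_(p,B) = X (p v + B)`): the common conclusion block of `SosBlindPlanes`,
`SosBlindPlanesLinear` and `sosBlindPlanes_allOrders`. -/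
def BlindAt (d n : ℕ) : Prop :=
  ∃ E : MvPolynomial ℕ ℝ →ₗ[ℝ] ℝ, IsPseudoexpectation d E ∧
    (∀ w : ℕ, SatisfiesIdentity d E (boolAxiom w)) ∧
    (∀ p < n ^ 2 + n + 1, SatisfiesIdentity d E
      ((∑ B ∈ Finset.range (n ^ 2 + n + 1), MvPolynomial.X (p * (n ^ 2 + n + 1) + B)) -
        MvPolynomial.C ((n + 1 : ℕ) : ℝ))) ∧
    (∀ B < n ^ 2 + n + 1, SatisfiesIdentity d E
      ((∑ p ∈ Finset.range (n ^ 2 + n + 1), MvPolynomial.X (p * (n ^ 2 + n + 1) + B)) -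
        MvPolynomial.C ((n + 1 : ℕ) : ℝ))) ∧
    (∀ p < n ^ 2 + n + 1, ∀ p' < n ^ 2 + n + 1, p ≠ p' → SatisfiesIdentity d E
      ((∑ B ∈ Finset.range (n ^ 2 + n + 1), MvPolynomial.X (p * (n ^ 2 + n + 1) + B) *
        MvPolynomial.X (p' * (n ^ 2 + n + 1) + B)) - MvPolynomial.C (1 : ℝ))) ∧
    (∀ B < n ^ 2 + n + 1, ∀ B' < n ^ 2 + n + 1, B ≠ B' → SatisfiesIdentity d E
      ((∑ p ∈ Finset.range (n ^ 2 + n + 1), MvPolynomial.X (p * (n ^ 2 + n + 1) + B) *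
        MvPolynomial.X (p * (n ^ 2 + n + 1) + B')) - MvPolynomial.C (1 : ℝ)))

/-- GRADED FAMILY I (threshold functions): for every degree `d`, every Bruck–Ryser–Chowla excluded
order `n ≥ N d` is degree-`d` blind. -/
def ThreshRung (N : ℕ → ℕ) : Prop :=
  ∀ d : ℕ, ∀ n ≥ N d, (n % 4 = 1 ∨ n % 4 = 2) → (¬ ∃ a b : ℕ, a ^ 2 + b ^ 2 = n) → BlindAt d n

/-- GRADED FAMILY II (degree profiles): eventually every BRC-excluded order `n` is degree-`f n`
blind. -/
def DegreeRung (f : ℕ → ℕ) : Prop :=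
  ∃ N : ℕ, ∀ n ≥ N, (n % 4 = 1 ∨ n % 4 = 2) → (¬ ∃ a b : ℕ, a ^ 2 + b ^ 2 = n) → BlindAt (f n) n

/-- **THE RUNG.** Effective `SosBlindPlanes` with a threshold singly exponential in `d log d`
(the scale of the floor's own trace board `Nsos d ≤ (d+2)^{2(d+2)}`): there is `C` such that for
every `d` and every BRC-excluded `n ≥ (d+2)^{C(d+2)}` the plane system of order `n` has a degree-`d`
pseudoexpectation. Equivalently: degree-`⌊c log n / log log n⌋` SOS does not refute `¬PP(n)`. -/
def EffectiveSosBlindPlanes : Prop :=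
  ∃ C : ℕ, ThreshRung (fun d => (d + 2) ^ (C * (d + 2)))

/-! ### Placing floor, rung and crux in the families (all by unfolding) -/

theorem sosBlindPlanes_iff_exists_threshRung : SosBlindPlanes ↔ ∃ N, ThreshRung N := by
  constructor
  · intro h
    choose N hN using h
    exact ⟨N, hN⟩
  · rintro ⟨N, hN⟩ d
    exact ⟨N d, hN d⟩

theorem sosBlindPlanes_iff_degreeRung_const : SosBlindPlanes ↔ ∀ d, DegreeRung (fun _ => d) :=
  Iff.rfl

theorem sosBlindPlanesLinear_iff_degreeRung :
    SosBlindPlanesLinear ↔ ∃ ε : ℝ, 0 < ε ∧ DegreeRung (fun n => ⌊ε * ((n ^ 2 + n + 1 : ℕ) : ℝ)⌋₊) :=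
  Iff.rfl

/-- The floor at its own threshold function is a rung of family I (F3 witness). -/
theorem floor_threshRung : ThreshRung (fun d => Classical.choose (sosBlindPlanes_proof d)) :=
  fun d => Classical.choose_spec (sosBlindPlanes_proof d)

/-- The floor, as `∃ N, ThreshRung N`. -/
theorem floor_exists_threshRung : ∃ N, ThreshRung N :=
  sosBlindPlanes_iff_exists_threshRung.1 sosBlindPlanes_proof

/-- Rung ⇒ floor (downward direction of the ladder). -/
theorem effective_imp_floor : EffectiveSosBlindPlanes → SosBlindPlanes := by
  rintro ⟨C, hC⟩ d
  exact ⟨(d + 2) ^ (C * (d + 2)), hC d⟩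

/-! ### Degree monotonicity and crux ⇒ rung (the rung is a necessary waypoint of K3) -/

theorem isPseudoexpectation_mono {d D : ℕ} (h : d ≤ D) {E : MvPolynomial ℕ ℝ →ₗ[ℝ] ℝ}
    (hE : IsPseudoexpectation D E) : IsPseudoexpectation d E :=
  ⟨hE.1, fun p hp => hE.2 p (hp.trans h)⟩

theorem satisfiesIdentity_mono {d D : ℕ} (h : d ≤ D) {E : MvPolynomial ℕ ℝ →ₗ[ℝ] ℝ}
    {q : MvPolynomial ℕ ℝ} (hE : SatisfiesIdentity D E q) : SatisfiesIdentity d E q :=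
  fun r hr => hE r (hr.trans h)

theorem blindAt_mono {d D n : ℕ} (h : d ≤ D) : BlindAt D n → BlindAt d n := by
  rintro ⟨E, h1, h2, h3, h4, h5, h6⟩
  exact ⟨E, isPseudoexpectation_mono h h1, fun w => satisfiesIdentity_mono h (h2 w),
    fun p hp => satisfiesIdentity_mono h (h3 p hp), fun B hB => satisfiesIdentity_mono h (h4 B hB),
    fun p hp p' hp' hne => satisfiesIdentity_mono h (h5 p hp p' hp' hne),
    fun B hB B' hB' hne => satisfiesIdentity_mono h (h6 B hB B' hB' hne)⟩

/-- An elementary growth fact: `C < 2 ^ C ≤ (d+2)^C`, and `(d+2)^(C+1) ≤ (d+2)^(C (d+2))` for `C ≥ 1`. -/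
theorem succ_mul_le_pow {C d : ℕ} (hC : 1 ≤ C) : (C + 1) * (d + 2) ≤ (d + 2) ^ (C * (d + 2)) := by
  have h2 : 2 ≤ d + 2 := by omega
  have hC2 : C + 1 ≤ 2 ^ C := Nat.lt_two_pow_self
  calc (C + 1) * (d + 2) ≤ 2 ^ C * (d + 2) := Nat.mul_le_mul_right _ hC2
    _ ≤ (d + 2) ^ C * (d + 2) := Nat.mul_le_mul_right _ (Nat.pow_le_pow_left h2 C)
    _ = (d + 2) ^ (C + 1) := (pow_succ _ _).symm
    _ ≤ (d + 2) ^ (C * (d + 2)) := Nat.pow_le_pow_right (by omega) (by nlinarith)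

/-- **K3 ⇒ rung**: linear-degree blindness implies the effective fixed-degree rung. -/
theorem linear_imp_effective : SosBlindPlanesLinear → EffectiveSosBlindPlanes := by
  rintro ⟨ε, hε, N, hN⟩
  refine ⟨max N (⌈ε⁻¹⌉₊ + 1), fun d n hn h4 hsq => ?_⟩
  set C : ℕ := max N (⌈ε⁻¹⌉₊ + 1) with hCdef
  have hC1 : 1 ≤ C := le_max_of_le_right (Nat.le_add_left 1 _)
  have hkey : (C + 1) * (d + 2) ≤ n := (succ_mul_le_pow hC1).trans hn
  have hNn : N ≤ n := by
    have : C ≤ (C + 1) * (d + 2) := by nlinarith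
    exact (le_max_left _ _).trans (this.trans hkey)
  obtain ⟨E, hE⟩ := hN n hNn h4 hsq
  refine blindAt_mono ?_ ⟨E, hE⟩
  -- `d ≤ ⌊ε (n² + n + 1)⌋₊`
  apply Nat.le_floor
  have hceil : ε⁻¹ ≤ (⌈ε⁻¹⌉₊ : ℝ) := Nat.le_ceil _
  have hCr : ε⁻¹ ≤ (C : ℝ) := by
    have : (⌈ε⁻¹⌉₊ : ℝ) + 1 ≤ (C : ℝ) := by
      have h := le_max_right N (⌈ε⁻¹⌉₊ + 1)
      exact_mod_cast h
    linarith
  have hkeyr : ((C : ℝ) + 1) * ((d : ℝ) + 2) ≤ (n : ℝ) := by exact_mod_cast hkey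
  have hnv : (n : ℝ) ≤ ((n ^ 2 + n + 1 : ℕ) : ℝ) := by
    have : n ≤ n ^ 2 + n + 1 := by nlinarith
    exact_mod_cast this
  have hd0 : (0 : ℝ) ≤ d := Nat.cast_nonneg d
  have hC0 : (0 : ℝ) ≤ C := Nat.cast_nonneg C
  -- ε⁻¹ (d + 2) ≤ (C+1)(d+2) ≤ n ≤ v, hence d ≤ d + 2 ≤ ε v
  have h1 : ε⁻¹ * ((d : ℝ) + 2) ≤ ((n ^ 2 + n + 1 : ℕ) : ℝ) := by
    calc ε⁻¹ * ((d : ℝ) + 2) ≤ ((C : ℝ) + 1) * ((d : ℝ) + 2) := by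
          apply mul_le_mul_of_nonneg_right _ (by linarith)
          linarith
      _ ≤ (n : ℝ) := hkeyr
      _ ≤ _ := hnv
  have h2 : (d : ℝ) + 2 ≤ ε * ((n ^ 2 + n + 1 : ℕ) : ℝ) := by
    have := mul_le_mul_of_nonneg_left h1 hε.le
    rwa [← mul_assoc, mul_inv_cancel₀ hε.ne', one_mul] at this
  linarith


/-! ### The floor's Build at an explicit order (proved) -/

/-- From a good template table at an order beyond the trace board to degree-`d` blindness: the
floor's Build section (`isPseudoexpectation_Efun`, `satisfiesIdentity_rowLin/colLin/rowQuad/colQuad`,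
`Efun_boolAxiom_mul`), verbatim. [KMOW 2017, Defs. 2.7–2.8] [folklore] -/
theorem blindAt_of_goodPt {d n : ℕ} {μ : Tmpl d → ℝ} (hgood : GoodPt d (n : ℝ) μ)
    (hn' : Nsos d + (d + 1) ≤ n) : BlindAt d n := by
  have hv : n ≤ n ^ 2 + n + 1 := by nlinarith
  have hNv : Nsos d ≤ n ^ 2 + n + 1 := by omega
  have hDv : d + 1 ≤ n ^ 2 + n + 1 := by omega
  unfold BlindAt
  set v := n ^ 2 + n + 1 with hvdef
  refine ⟨Efun v (d + 1) μ, isPseudoexpectation_Efun hgood hDv hNv,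
    fun w => fun r _ => Efun_boolAxiom_mul μ w r, ?_, ?_, ?_, ?_⟩
  · intro p hp
    have h := satisfiesIdentity_rowLin hgood hDv ⟨p, hp⟩
    rw [Finset.sum_range fun B => MvPolynomial.X (p * v + B)]
    push_cast
    exact h
  · intro B hB
    have h := satisfiesIdentity_colLin hgood hDv ⟨B, hB⟩
    rw [Finset.sum_range fun p => MvPolynomial.X (p * v + B)]
    push_cast
    exact h
  · intro p hp p' hp' hpp'
    have h := satisfiesIdentity_rowQuad hgood hDv (p := ⟨p, hp⟩) (p' := ⟨p', hp'⟩)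
      (fun h => hpp' (congrArg Fin.val h))
    rw [Finset.sum_range fun B => MvPolynomial.X (p * v + B) * MvPolynomial.X (p' * v + B)]
    exact h
  · intro B hB B' hB' hBB'
    have h := satisfiesIdentity_colQuad hgood hDv (B := ⟨B, hB⟩) (B' := ⟨B', hB'⟩)
      (fun h => hBB' (congrArg Fin.val h))
    rw [Finset.sum_range fun p => MvPolynomial.X (p * v + B) * MvPolynomial.X (p * v + B')]
    exact h

/-! ### Registered stubs -/

/-- **stub (load-bearing, L/XL): EFFECTIVE TRANSFER.** For all orders beyond a threshold singly
exponential in `d log d`, some `S_v × S_v`-invariant template table satisfies every constraint of the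
floor's transfer formula (`GoodPt`: invariance, normalisation, the four template identities at `x = n`,
the `K₁` Hankel/trace inequalities). The floor proves `∃ N₀, ∀ n ≥ N₀` (`exists_goodPt_of_large`)
NON-effectively (o-minimal eventual constancy of the projected semialgebraic set `feasSet d`, which
contains every prime `p ≥ Nsos d + d + 1`). Why plausibly true: the fibres of `feasSet d` are
spectrahedral (linear in the table, polynomial in `x`), non-empty at EVERY prime beyond the explicit
bound `Nsos d + d + 1`, and consecutive primes are within a factor 2 (Bertrand); a table for a
composite order should be obtainable from the genuine tables of neighbouring primes (scaling limit
of normalised tables along a Chebotarev class of primes + quantitative stability of strictly feasible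
spectrahedral systems, or direct prime-grafting). Why it might fail: the genuine moment matrices have
large kernels (incidence theorems: Desargues/Pappus ties between templates; Mnëv-universality makes
template zero-patterns depend on `p` for `d ≳ 24`), so stability margins may decay faster than any
`(d+2)^{-O(d)}`, forcing a larger (but still explicit) threshold — in which case the rung should be
re-typed with that threshold. -/
theorem stub_effectiveTransfer :
    ∃ C : ℕ, ∀ d n : ℕ, (d + 2) ^ (C * (d + 2)) ≤ n → ∃ μ : Tmpl d → ℝ, GoodPt d (n : ℝ) μ := by
  sorry

/-- **stub (S/M): EXPLICIT SIZE OF THE TRACE BOARD.** `Nsos d + (d+1) ≤ (d+2)^(2(d+2))`, from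
`|Idx (d+1) (d/2)| = #{S ⊆ (d+1)×(d+1) : |S| ≤ d/2} ≤ ∑_{j ≤ d/2} C((d+1)², j) ≤ (d+2)^d`, hence
`K₁ d ≤ (d+2)^{2d}` and `Nsos d = 2 K₁ d ⌊d/2⌋ + 1 ≤ (d+2)^{2d+1}`. (Checked by hand for
`d ≤ 4`: `Nsos = 1, 1, 201, 579, 425105`.) Why it might fail: only by an arithmetic slip in the
exponent; any polynomial-in-`(d+2)^d` bound serves the composition after adjusting `2`. -/
theorem stub_traceBoard_le_pow : ∀ d : ℕ, Nsos d + (d + 1) ≤ (d + 2) ^ (2 * (d + 2)) := by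
  sorry

/-! ### Composition (kernel-checked): the stubs prove the rung -/

/-- **The line closes the rung**: effective transfer + the explicit board size give
`EffectiveSosBlindPlanes` (with constant `max C 2`). -/
theorem EffectiveSosBlindPlanes_of
    (h₁ : ∃ C : ℕ, ∀ d n : ℕ, (d + 2) ^ (C * (d + 2)) ≤ n → ∃ μ : Tmpl d → ℝ, GoodPt d (n : ℝ) μ)
    (h₂ : ∀ d : ℕ, Nsos d + (d + 1) ≤ (d + 2) ^ (2 * (d + 2))) :
    EffectiveSosBlindPlanes := by
  obtain ⟨C, hC⟩ := h₁
  refine ⟨max C 2, fun d n hn _ _ => ?_⟩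
  have hd : 1 ≤ d + 2 := by omega
  have hCn : (d + 2) ^ (C * (d + 2)) ≤ n :=
    (Nat.pow_le_pow_right hd (Nat.mul_le_mul_right _ (le_max_left C 2))).trans hn
  have h2n : (d + 2) ^ (2 * (d + 2)) ≤ n :=
    (Nat.pow_le_pow_right hd (Nat.mul_le_mul_right _ (le_max_right C 2))).trans hn
  obtain ⟨μ, hgood⟩ := hC d n hCn
  exact blindAt_of_goodPt hgood ((h₂ d).trans h2n)

/-- The rung from the registered stubs, by name. -/
theorem effectiveSosBlindPlanes_of_stubs : EffectiveSosBlindPlanes :=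
  EffectiveSosBlindPlanes_of stub_effectiveTransfer stub_traceBoard_le_pow

/-- … and hence (downward) the floor again, and (upward) what K3 must in particular deliver. -/
example : EffectiveSosBlindPlanes → SosBlindPlanes := effective_imp_floor
example : SosBlindPlanesLinear → EffectiveSosBlindPlanes := linear_imp_effective

end Summit.PneNP.PneNP.Cruxes.SosBlindPlanesLinear.EffectiveThreshold
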